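import Mathlib
import HarnessLib
import Summits.Ventures.LatticeQCDFlow.Scoring.ReweightedEDFBand
import Summits.Ventures.LatticeQCDFlow.Scoring.TwoSampleEDFBand

/-!
# A finite-sample A-versus-B band for the PRINTED (reweighted) distribution functions of two
# independent flow codes sampling the same target through their own models, under weight
# ceilings: the two printed curves differ uniformly by less than `ε` except with probability at
# most `Σ_{X=A,B} (e^{−n_X/(2M_X²)} + 2(⌈4/ε⌉ + 1)·e^{−n_Xε²/(128M_X²)})`

HONEST FRAMING: exact (Metropolis-corrected) sampling algorithms for lattice gauge theory;
figures of merit are autocorrelation/cost numbers at stated couplings and volumes; no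
continuum-physics claim.

Venture `LatticeQCDFlow` (cell pub-lqcd), topic `Scoring`; FANOUT row 4 (`s0-u1-b`, rung S0-B:
two independent codes compared; the A-versus-B agreement table).
`Scoring/GlivenkoCantelli.reweightedEDF_AB_agree_ae` proved that the Kolmogorov distance between
the two codes' printed reweighted distribution functions of a statistic `O` tends to zero almost
surely; `Scoring/ReweightedEDFBand` gave the one-code finite-`n` band under a weight ceiling.
This file is the two-code corollary on `P_A ⊗ P_B`: codes `A` (stream `yᵢ`, model `q_A`,
ceiling `p/q_A ≤ M_A`, `n` draws) and `B` (`y'ᵢ`, `q_B`, `M_B`, `m` draws) target the SAME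
normalised `p` and print the reweighted distribution functions of the same measurable `O` with
any normalisations of their weights; then for `ε > 0`:
**`measureReal_exists_reweightedTwoSample_dev_ge_le`** —
`(P_A ⊗ P_B)(∃ t, ε ≤ |F̂ₙ^A(t) − F̂ₘ^B(t)|) ≤ Σ_X (e^{−n_X/(2M_X²)} + 2(⌈4/ε⌉ + 1)e^{−n_Xε²/(128M_X²)})`
(each code within `ε/2` of `F = cdf ρ` by the one-code band; outer measures and
`Measure.prod_prod`).  NEW WORK of the cell; no definition; nothing cited as a fact.

## Content

* **`measureReal_exists_reweightedTwoSample_dev_ge_le`** — the two-code band.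

NOT CLAIMED: the ceiling-free regime; dependent codes; any number of ours re-scored.
-/

noncomputable section

namespace Summit.Ventures.LatticeQCDFlow.Scoring.GlivenkoCantelli

open MeasureTheory ProbabilityTheory Finset Filter Function
open scoped Topology

section TwoCodes

variable {ΩA : Type*} [MeasurableSpace ΩA] {PA : Measure ΩA} [IsProbabilityMeasure PA]
variable {ΩB : Type*} [MeasurableSpace ΩB] {PB : Measure ΩB} [IsProbabilityMeasure PB]
variable {X : Type*} [MeasurableSpace X] {μ : Measure X} {p q q' O : X → ℝ}
variable {y : ℕ → ΩA → X} {y' : ℕ → ΩB → X}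

/-- **THE TWO-CODE FINITE-SAMPLE BAND FOR THE PRINTED DISTRIBUTION FUNCTIONS (weight
ceilings).**  Two independent codes target the same normalised `p ≥ 0` (`∫ p dμ = 1`) through
models `q_A, q_B > 0` with ceilings `p/q_A ≤ M_A`, `p/q_B ≤ M_B`, and print, for the same
measurable statistic `O`, the reweighted distribution functions `F̂ₙ^A`, `F̂ₘ^B` with weights of
any normalisation; `ε > 0`, `n, m ≥ 1`.  Then on `P_A ⊗ P_B`:
`P(∃ t, ε ≤ |F̂ₙ^A(t) − F̂ₘ^B(t)|) ≤ (e^{−n/(2M_A²)} + 2(⌈4/ε⌉ + 1)e^{−nε²/(128M_A²)})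
+ (e^{−m/(2M_B²)} + 2(⌈4/ε⌉ + 1)e^{−mε²/(128M_B²)})`. [ours] -/
theorem measureReal_exists_reweightedTwoSample_dev_ge_le (hym : ∀ j, Measurable (y j))
    (hind : iIndepFun y PA)
    (hlaw : ∀ j, Measure.map (y j) PA = μ.withDensity fun z => ENNReal.ofReal (q z))
    (hym' : ∀ j, Measurable (y' j)) (hind' : iIndepFun y' PB)
    (hlaw' : ∀ j, Measure.map (y' j) PB = μ.withDensity fun z => ENNReal.ofReal (q' z))
    (hp0 : ∀ z, 0 ≤ p z) (hpm : Measurable p) (hpi : Integrable p μ) (hp1 : ∫ z, p z ∂μ = 1)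
    (hq0 : ∀ z, 0 < q z) (hqm : Measurable q) (hq0' : ∀ z, 0 < q' z) (hqm' : Measurable q')
    (hOm : Measurable O) {MA MB : ℝ} (hMA0 : 0 < MA) (hMA : ∀ z, p z / q z ≤ MA)
    (hMB0 : 0 < MB) (hMB : ∀ z, p z / q' z ≤ MB) {wt wt' : X → ℝ} {c c' : ℝ} (hc : 0 < c)
    (hwt : ∀ z, wt z = c * (p z / q z)) (hc' : 0 < c') (hwt' : ∀ z, wt' z = c' * (p z / q' z))
    {ε : ℝ} (hε : 0 < ε) {n m : ℕ} (hn : 1 ≤ n) (hm : 1 ≤ m) :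
    (PA.prod PB).real {ω : ΩA × ΩB | ∃ t : ℝ, ε
        ≤ |(∑ i ∈ range n, wt (y i ω.1) * (Set.Iic t).indicator (1 : ℝ → ℝ) (O (y i ω.1)))
            / (∑ i ∈ range n, wt (y i ω.1))
          - (∑ i ∈ range m, wt' (y' i ω.2) * (Set.Iic t).indicator (1 : ℝ → ℝ) (O (y' i ω.2)))
            / (∑ i ∈ range m, wt' (y' i ω.2))|}
      ≤ (Real.exp (-(n / (2 * MA ^ 2)))
          + 2 * ((⌈4 / ε⌉₊ : ℝ) + 1) * Real.exp (-(n * ε ^ 2 / (128 * MA ^ 2))))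
        + (Real.exp (-(m / (2 * MB ^ 2)))
          + 2 * ((⌈4 / ε⌉₊ : ℝ) + 1) * Real.exp (-(m * ε ^ 2 / (128 * MB ^ 2)))) := by
  have hε2 : 0 < ε / 2 := half_pos hε
  have hA := measureReal_exists_reweightedEDF_dev_ge_le_of_pos hym hind hlaw hp0 hpm hpi hp1
    hq0 hqm hOm hMA0 hMA hc hwt hε2 hn
  have hB := measureReal_exists_reweightedEDF_dev_ge_le_of_pos hym' hind' hlaw' hp0 hpm hpi hp1
    hq0' hqm' hOm hMB0 hMB hc' hwt' hε2 hm
  have e4 : (2 : ℝ) / (ε / 2) = 4 / ε := by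
    field_simp
    ring
  rw [e4] at hA hB
  set F : ℝ → ℝ := fun t => cdf ((μ.withDensity fun z => ENNReal.ofReal (p z)).map O) t with hF
  -- the one-code deviation events
  set SA : Set ΩA := {ω | ∃ t : ℝ, ε / 2 ≤ |F t
    - (∑ i ∈ range n, wt (y i ω) * (Set.Iic t).indicator (1 : ℝ → ℝ) (O (y i ω)))
      / (∑ i ∈ range n, wt (y i ω))|} with hSA
  set SB : Set ΩB := {ω | ∃ t : ℝ, ε / 2 ≤ |F t
    - (∑ i ∈ range m, wt' (y' i ω) * (Set.Iic t).indicator (1 : ℝ → ℝ) (O (y' i ω)))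
      / (∑ i ∈ range m, wt' (y' i ω))|} with hSB
  have hsub : {ω : ΩA × ΩB | ∃ t : ℝ, ε
      ≤ |(∑ i ∈ range n, wt (y i ω.1) * (Set.Iic t).indicator (1 : ℝ → ℝ) (O (y i ω.1)))
          / (∑ i ∈ range n, wt (y i ω.1))
        - (∑ i ∈ range m, wt' (y' i ω.2) * (Set.Iic t).indicator (1 : ℝ → ℝ) (O (y' i ω.2)))
          / (∑ i ∈ range m, wt' (y' i ω.2))|}
      ⊆ SA ×ˢ (Set.univ : Set ΩB) ∪ (Set.univ : Set ΩA) ×ˢ SB := by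
    rintro ω ⟨t, ht⟩
    by_contra hgood
    simp only [Set.mem_union, Set.mem_prod, Set.mem_univ, and_true, true_and, not_or, hSA, hSB,
      Set.mem_setOf_eq, not_exists, not_le] at hgood
    have h1 := hgood.1 t
    have h2 := hgood.2 t
    exact absurd ht (not_le.2 (abs_sub_lt_of_abs_sub_lt h1 h2))
  calc (PA.prod PB).real {ω : ΩA × ΩB | ∃ t : ℝ, ε
        ≤ |(∑ i ∈ range n, wt (y i ω.1) * (Set.Iic t).indicator (1 : ℝ → ℝ) (O (y i ω.1)))
            / (∑ i ∈ range n, wt (y i ω.1))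
          - (∑ i ∈ range m, wt' (y' i ω.2) * (Set.Iic t).indicator (1 : ℝ → ℝ) (O (y' i ω.2)))
            / (∑ i ∈ range m, wt' (y' i ω.2))|}
      ≤ (PA.prod PB).real (SA ×ˢ (Set.univ : Set ΩB) ∪ (Set.univ : Set ΩA) ×ˢ SB) :=
        measureReal_mono hsub (measure_ne_top _ _)
    _ ≤ (PA.prod PB).real (SA ×ˢ (Set.univ : Set ΩB))
        + (PA.prod PB).real ((Set.univ : Set ΩA) ×ˢ SB) := measureReal_union_le _ _
    _ = PA.real SA + PB.real SB := by
        simp only [measureReal_def, Measure.prod_prod, measure_univ, mul_one, one_mul]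
    _ ≤ _ := add_le_add hA hB
    _ = _ := by
        have en : -((n : ℝ) * (ε / 2) ^ 2 / (32 * MA ^ 2)) = -(n * ε ^ 2 / (128 * MA ^ 2)) := by
          ring
        have em : -((m : ℝ) * (ε / 2) ^ 2 / (32 * MB ^ 2)) = -(m * ε ^ 2 / (128 * MB ^ 2)) := by
          ring
        rw [en, em]

end TwoCodes

end Summit.Ventures.LatticeQCDFlow.Scoring.GlivenkoCantelli

end
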